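import Summits.HubbardSuperconductivity.HubbardSuperconductivity.Theses.AnisotropyChord

/-!
# Route `AnisotropyChord` — support `ChordToOrderFM`

`ChordToOrderFM` (stmt-HubbardSuperconductivity-8152): `ChordFM → HalfFilledOrder`. The ferromagnetic
chord gives, for every even side `M ≥ 4`, every `Δ ∈ [-1, 1]` and every normalised `S^z = 0`
ground state `ψ` of the XXZ torus, `(1+Δ)/2 · (M²/2)(M²/2 + 1) ≤ Re⟨ψ, S⁺S⁻ ψ⟩`
(`S^± = Σ_x S^±_x`); for `Δ ∈ (-1, 0]` this is the uniform floor `c M⁴` with `c := (1+Δ)/8 > 0`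
(since `(M²/2)(M²/2+1) ≥ M⁴/4`), i.e. `HalfFilledOrder` with `M₀ := 4`. Elementary arithmetic.

Source: T. Kennedy, E. H. Lieb, B. S. Shastry, J. Stat. Phys. 53 (1988) 1019 (XY order at half
filling — context only). No new definitions.
-/

-- the mandated namespace `Summit.<Summit>.<Problem>.Theorems` repeats `HubbardSuperconductivity`
-- (single-problem summit, D-0017), which the `dupNamespace` linter flags on every declaration
set_option linter.dupNamespace false

namespace Summit.HubbardSuperconductivity.HubbardSuperconductivity.Theorems.AnisotropyChord

open Summit.HubbardSuperconductivity.HubbardSuperconductivity.Theses.AnisotropyChord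

/-- **`ChordToOrderFM`** (stmt-HubbardSuperconductivity-8152): `ChordFM → HalfFilledOrder` with
`c := (1+Δ)/8` and `M₀ := 4`, because `(1+Δ)/8 · M⁴ ≤ (1+Δ)/2 · (M²/2)(M²/2+1)` for `Δ > -1`.
[folklore] -/
theorem chordToOrderFM_proof :
    Summit.HubbardSuperconductivity.HubbardSuperconductivity.Theses.AnisotropyChord.ChordToOrderFM := by
  unfold ChordToOrderFM ChordFM HalfFilledOrder
  intro hFM Δ hΔ
  have hΔ1 : 0 < 1 + Δ := by linarith [hΔ.1]
  refine ⟨(1 + Δ) / 8, by positivity, 4, ?_⟩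
  intro M _ hE hM ψ hψS hψ1 hgs
  have h := hFM M hE hM Δ ⟨by linarith [hΔ.1], by linarith [hΔ.2]⟩ ψ hψS hψ1 hgs
  have hM2 : (0 : ℝ) ≤ (M : ℝ) ^ 2 := by positivity
  have key : (1 + Δ) / 8 * (M : ℝ) ^ 4 ≤
      (1 + Δ) / 2 * ((M : ℝ) ^ 2 / 2 * ((M : ℝ) ^ 2 / 2 + 1)) := by
    nlinarith
  exact key.trans h

end Summit.HubbardSuperconductivity.HubbardSuperconductivity.Theorems.AnisotropyChord
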